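import Summits.QuantumFields.YangMills.Theorems.ColdStartUniversalityLatticeLangevinLatitudeGenerator
import Literature.Analysis.SpecialFunctions.GegenbauerSupBound
import Mathlib.Analysis.ODE.Gronwall
import Mathlib.MeasureTheory.Integral.IntervalIntegral.FundThmCalculus
import HarnessLib

/-!
# Route `ColdStartUniversality`, crux K_A1 `UniformColdStartMixing` (stmt-QuantumFields-24809), rung `stub_fixedCutoffMixing`:
# latitude eigenfunctions — products of Chebyshev polynomials `U_n = C_n^{(1)}` — and the linear ODE `φ' = -λ φ` in integral form

Helper file (seat `ym-line-csu-p1`, g7), calculus behind the closed-form expectations of latitude eigenfunctions along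
the `β' = 0` SU(2) lattice Langevin dynamics (Brownian motion on `SU(2)^E`):

* `contDiff_gegenbauerSum` — the explicit Gegenbauer sums `C_n^{(a)}` (`Literature…GegenbauerExplicitODE`) are smooth;
* `fderiv_prod_gegenbauer_single`, `fderiv_fderiv_prod_gegenbauer_single` — coordinate derivatives of the product
  `Φ(s) = ∏_e C_{m_e}^{(1)}(s_e)`;
* `jacobi_prod_gegenbauer` — **eigenfunction identity**: `Σ_e [½(1 - s_e²) ∂²_{ee}Φ - (3/2) s_e ∂_eΦ] = -(Σ_e m_e(m_e+2)/2) Φ`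
  (the ultraspherical equation `(1-s²)C'' - 3sC' + n(n+2)C = 0` at `a = 1`, i.e. for the Chebyshev polynomials of the
  second kind, latitude by latitude);
* `eq_mul_exp_of_integral_eq` — a bounded measurable `φ` with `φ(t) = c - λ ∫₀ᵗ φ` for `t ≥ 0` is `c e^{-λt}` (FTC for
  the right derivative + Grönwall uniqueness `eq_zero_of_abs_deriv_le_mul_abs_self_of_eq_zero_right`).

No definition, no sorry.  RECORD-rung R3 plumbing; nothing here bears on the mass gap.
-/

set_option autoImplicit false

noncomputable section

namespace Summit.QuantumFields.YangMills.Theorems.ColdStartUniversality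

open MeasureTheory Finset Set Filter
open scoped BigOperators Topology
open Literature.Analysis.SpecialFunctions (gegenbauerSum gegenbauerSumD gegenbauerSumDD hasDerivAt_gegenbauerSum
  hasDerivAt_gegenbauerSumD gegenbauerSum_ode)

/-! ### Smoothness of the Gegenbauer sums -/

/-- The explicit Gegenbauer sum `C_n^{(a)}` is a smooth function (a polynomial). [folklore] -/
theorem contDiff_gegenbauerSum (a : ℝ) (n : ℕ) {m : WithTop ℕ∞} : ContDiff ℝ m (gegenbauerSum a n) := by
  have h : gegenbauerSum a n = fun s => ∑ l ∈ Finset.range (n / 2 + 1),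
      Literature.Analysis.SpecialFunctions.gegenbauerCoeff a n l * (2 * s) ^ (n - 2 * l) := by
    funext s; rfl
  rw [h]
  refine ContDiff.sum fun l _ => contDiff_const.mul ((contDiff_const.mul contDiff_id).pow _)

/-- The derivative sum `C_n^{(a)}'` is smooth. [folklore] -/
theorem contDiff_gegenbauerSumD (a : ℝ) (n : ℕ) {m : WithTop ℕ∞} : ContDiff ℝ m (gegenbauerSumD a n) := by
  have h : gegenbauerSumD a n = fun s => ∑ l ∈ Finset.range (n / 2 + 1),
      Literature.Analysis.SpecialFunctions.gegenbauerCoeff a n l *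
        (((n - 2 * l : ℕ) : ℝ) * (2 * s) ^ (n - 2 * l - 1) * 2) := by
    funext s; rfl
  rw [h]
  refine ContDiff.sum fun l _ => contDiff_const.mul
    ((contDiff_const.mul ((contDiff_const.mul contDiff_id).pow _)).mul contDiff_const)

/-! ### Coordinate derivatives of a product of one-variable functions -/

section ProductCalculus

variable {E' : Type} [Fintype E'] [DecidableEq E']

/-- Product rule along a coordinate: for `Φ(s) = ∏_e G_e(s_e)` with differentiable `G_e` (derivatives `D_e`),
`∂_e Φ(s) = D_e(s_e) ∏_{e' ≠ e} G_{e'}(s_{e'})`. [folklore] -/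
theorem fderiv_prod_single {G D : E' → ℝ → ℝ} (hG : ∀ e x, HasDerivAt (G e) (D e x) x) (s : E' → ℝ) (e : E') :
    fderiv ℝ (fun z : E' → ℝ => ∏ e', G e' (z e')) s (Pi.single e 1) =
      D e (s e) * ∏ e' ∈ univ.erase e, G e' (s e') := by
  have hcomp : ∀ e', HasFDerivAt (fun z : E' → ℝ => G e' (z e'))
      ((D e' (s e')) • ContinuousLinearMap.proj (R := ℝ) (φ := fun _ : E' => ℝ) e') s := by
    intro e'
    have h1 := (hG e' (s e')).hasFDerivAt
    have h2 := hasFDerivAt_apply (𝕜 := ℝ) e' s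
    have h3 := h1.comp s h2
    have heq : (ContinuousLinearMap.toSpanSingleton ℝ (D e' (s e'))).comp
        (ContinuousLinearMap.proj (R := ℝ) (φ := fun _ : E' => ℝ) e') =
        (D e' (s e')) • ContinuousLinearMap.proj (R := ℝ) (φ := fun _ : E' => ℝ) e' := by
      ext v
      simp [mul_comm]
    rw [heq] at h3
    exact h3
  have hprod := HasFDerivAt.finsetProd (u := univ) (fun e' _ => hcomp e')
  rw [hprod.fderiv]
  simp only [_root_.sum_apply, _root_.smul_apply, ContinuousLinearMap.proj_apply, smul_eq_mul]
  rw [Finset.sum_eq_single e]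
  · rw [Pi.single_eq_same]; ring
  · intro e' _ hne
    rw [Pi.single_eq_of_ne hne]; ring
  · intro h; exact absurd (Finset.mem_univ e) h

/-- Second coordinate derivative of `Φ(s) = ∏_e G_e(s_e)`: `∂²_{ee} Φ(s) = DD_e(s_e) ∏_{e' ≠ e} G_{e'}(s_{e'})` for
twice differentiable `G_e` (`G' = D`, `D' = DD`). [folklore] -/
theorem fderiv_fderiv_prod_single {G D DD : E' → ℝ → ℝ} (hG : ∀ e x, HasDerivAt (G e) (D e x) x)
    (hD : ∀ e x, HasDerivAt (D e) (DD e x) x) (s : E' → ℝ) (e : E') :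
    fderiv ℝ (fun z : E' → ℝ => fderiv ℝ (fun z' : E' → ℝ => ∏ e', G e' (z' e')) z (Pi.single e 1)) s
        (Pi.single e 1) = DD e (s e) * ∏ e' ∈ univ.erase e, G e' (s e') := by
  have hfun : (fun z : E' → ℝ => fderiv ℝ (fun z' : E' → ℝ => ∏ e', G e' (z' e')) z (Pi.single e 1)) =
      fun z : E' → ℝ => ∏ e', (Function.update G e (D e)) e' (z e') := by
    funext z
    rw [fderiv_prod_single hG z e, ← Finset.mul_prod_erase univ _ (Finset.mem_univ e)]
    congr 1
    · simp
    · exact Finset.prod_congr rfl fun e' he' => by rw [Function.update_of_ne (ne_of_mem_erase he')]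
  rw [hfun]
  have hG' : ∀ e' x, HasDerivAt ((Function.update G e (D e)) e') ((Function.update D e (DD e)) e' x) x := by
    intro e' x
    by_cases h : e' = e
    · subst h; simp only [Function.update_self]; exact hD e' x
    · simp only [Function.update_of_ne h]; exact hG e' x
  rw [fderiv_prod_single hG' s e]
  simp only [Function.update_self]
  congr 1
  exact Finset.prod_congr rfl fun e' he' => by rw [Function.update_of_ne (ne_of_mem_erase he')]

end ProductCalculus

/-! ### The latitude eigenfunction identity -/

/-- **`Φ(s) = ∏_e U_{m_e}(s_e)` is an eigenfunction of the latitude-wise Jacobi operator**: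
`Σ_e [½ (1 - s_e²) ∂²_{ee}Φ(s) + (-3/2 · s_e + 0) ∂_eΦ(s)] = -(Σ_e m_e (m_e + 2) / 2) · Φ(s)`, where
`U_n = C_n^{(1)} = gegenbauerSum 1 n` satisfies `(1 - s²) U'' - 3 s U' + n (n + 2) U = 0`. [folklore] -/
theorem jacobi_prod_gegenbauer {E' : Type} [Fintype E'] [DecidableEq E'] (m : E' → ℕ) (s : E' → ℝ) :
    ∑ e, ((1 / 2) * (1 - s e ^ 2) *
        fderiv ℝ (fun z : E' → ℝ => fderiv ℝ (fun z' : E' → ℝ => ∏ e', gegenbauerSum 1 (m e') (z' e')) z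
          (Pi.single e 1)) s (Pi.single e 1) +
      (-(3 / 2) * s e + 0) * fderiv ℝ (fun z' : E' → ℝ => ∏ e', gegenbauerSum 1 (m e') (z' e')) s (Pi.single e 1)) =
    -(∑ e, (m e : ℝ) * ((m e : ℝ) + 2) / 2) * ∏ e', gegenbauerSum 1 (m e') (s e') := by
  have hG : ∀ (e : E') (x : ℝ), HasDerivAt (gegenbauerSum 1 (m e)) (gegenbauerSumD 1 (m e) x) x :=
    fun e x => hasDerivAt_gegenbauerSum 1 (m e) x
  have hD : ∀ (e : E') (x : ℝ), HasDerivAt (gegenbauerSumD 1 (m e)) (gegenbauerSumDD 1 (m e) x) x :=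
    fun e x => hasDerivAt_gegenbauerSumD 1 (m e) x
  simp_rw [fderiv_prod_single (G := fun e => gegenbauerSum 1 (m e)) (D := fun e => gegenbauerSumD 1 (m e)) hG s,
    fderiv_fderiv_prod_single (G := fun e => gegenbauerSum 1 (m e)) (D := fun e => gegenbauerSumD 1 (m e))
      (DD := fun e => gegenbauerSumDD 1 (m e)) hG hD s]
  rw [neg_mul, Finset.sum_mul, ← Finset.sum_neg_distrib]
  refine Finset.sum_congr rfl fun e _ => ?_
  have hode := gegenbauerSum_ode 1 (m e) (s e)
  rw [← Finset.mul_prod_erase univ (fun e' => gegenbauerSum 1 (m e') (s e')) (Finset.mem_univ e)]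
  have h3 : (2 * (1 : ℝ) + 1) = 3 := by norm_num
  rw [h3] at hode
  -- `½(1-s²)DD·R - (3/2) s D·R = -(m(m+2)/2) C·R`
  have key : (1 / 2) * (1 - s e ^ 2) * gegenbauerSumDD 1 (m e) (s e) + (-(3 / 2) * s e + 0) * gegenbauerSumD 1 (m e) (s e)
      = -((m e : ℝ) * ((m e : ℝ) + 2) / 2) * gegenbauerSum 1 (m e) (s e) := by
    linear_combination (1 / 2 : ℝ) * hode
  calc (1 / 2) * (1 - s e ^ 2) * (gegenbauerSumDD 1 (m e) (s e) * ∏ e' ∈ univ.erase e, gegenbauerSum 1 (m e') (s e')) +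
        (-(3 / 2) * s e + 0) * (gegenbauerSumD 1 (m e) (s e) * ∏ e' ∈ univ.erase e, gegenbauerSum 1 (m e') (s e'))
      = ((1 / 2) * (1 - s e ^ 2) * gegenbauerSumDD 1 (m e) (s e) + (-(3 / 2) * s e + 0) * gegenbauerSumD 1 (m e) (s e))
          * ∏ e' ∈ univ.erase e, gegenbauerSum 1 (m e') (s e') := by ring
    _ = -((m e : ℝ) * ((m e : ℝ) + 2) / 2 * (gegenbauerSum 1 (m e) (s e) *
          ∏ e' ∈ univ.erase e, gegenbauerSum 1 (m e') (s e'))) := by rw [key]; ring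

/-! ### The linear ODE `φ' = -λ φ` in integral form -/

/-- **A bounded measurable `φ : ℝ → ℝ` with `φ(t) = c - λ ∫_{(0,t]} φ` for all `t ≥ 0` is `φ(t) = c e^{-λ t}`.**
(The integral equation makes `φ` continuous on `[0, ∞)`; the fundamental theorem of calculus gives the right
derivative `-λ φ`; Grönwall's uniqueness lemma concludes.) [folklore] -/
theorem eq_mul_exp_of_integral_eq {φ : ℝ → ℝ} {c lam B : ℝ} (hm : Measurable φ) (hB : ∀ r, |φ r| ≤ B)
    (h : ∀ t, 0 ≤ t → φ t = c - lam * ∫ r in Set.Ioc 0 t, φ r) :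
    ∀ t, 0 ≤ t → φ t = c * Real.exp (-lam * t) := by
  -- integrability on every interval
  have hint : ∀ a b : ℝ, IntervalIntegrable φ volume a b := by
    intro a b
    refine (intervalIntegrable_iff).2 (Measure.integrableOn_of_bounded (M := B) measure_Ioc_lt_top.ne
      hm.aestronglyMeasurable ?_)
    exact Eventually.of_forall fun r => by rw [Real.norm_eq_abs]; exact hB r
  -- the continuous primitive `ψ`
  set ψ : ℝ → ℝ := fun u => c - lam * ∫ r in (0 : ℝ)..u, φ r with hψ
  have hψcont : Continuous ψ :=
    continuous_const.sub (continuous_const.mul (intervalIntegral.continuous_primitive hint 0))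
  have hφψ : ∀ u, 0 ≤ u → φ u = ψ u := by
    intro u hu
    simp only [hψ]
    rw [intervalIntegral.integral_of_le hu]
    exact h u hu
  -- right continuity of `φ` at points of `[0, ∞)`
  have hφcont : ∀ b, 0 ≤ b → ContinuousWithinAt φ (Ioi b) b := by
    intro b hb
    have hev : φ =ᶠ[𝓝[Ioi b] b] ψ :=
      eventually_nhdsWithin_of_forall fun u hu => hφψ u (hb.trans (le_of_lt hu))
    exact (hψcont.continuousAt.continuousWithinAt).congr_of_eventuallyEq hev (hφψ b hb)
  -- right derivative of `ψ`
  have hψderiv : ∀ b, 0 ≤ b → HasDerivWithinAt ψ (-lam * ψ b) (Ici b) b := by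
    intro b hb
    have hI : HasDerivWithinAt (fun u => ∫ r in (0 : ℝ)..u, φ r) (φ b) (Ici b) b :=
      intervalIntegral.integral_hasDerivWithinAt_right (hint 0 b)
        (hm.stronglyMeasurable.stronglyMeasurableAtFilter) (hφcont b hb)
    have h2 := (hI.const_mul lam).const_sub c
    rw [hφψ b hb] at h2
    have h3 : -lam * ψ b = -(lam * ψ b) := by ring
    rw [h3]
    exact h2
  -- Grönwall uniqueness for `D = ψ - c e^{-λ·}`
  intro t ht
  set D : ℝ → ℝ := fun u => ψ u - c * Real.exp (-lam * u) with hD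
  have hDcont : ContinuousOn D (Icc 0 t) :=
    (hψcont.sub (continuous_const.mul (Real.continuous_exp.comp (continuous_const.mul continuous_id)))).continuousOn
  have hDderiv : ∀ x ∈ Ico 0 t, HasDerivWithinAt D (-lam * D x) (Ici x) x := by
    intro x hx
    have h1 := hψderiv x hx.1
    have h2 : HasDerivWithinAt (fun u => c * Real.exp (-lam * u)) (c * (Real.exp (-lam * x) * (-lam * 1))) (Ici x) x :=
      (((hasDerivAt_id x).const_mul (-lam)).exp.const_mul c).hasDerivWithinAt
    have h3 : -lam * D x = -lam * ψ x - c * (Real.exp (-lam * x) * (-lam * 1)) := by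
      simp only [hD]; ring
    rw [h3]
    exact h1.sub h2
  have hD0 : D 0 = 0 := by
    show ψ 0 - c * Real.exp (-lam * 0) = 0
    simp [hψ]
  have hbound : ∀ x ∈ Ico 0 t, ‖-lam * D x‖ ≤ |lam| * ‖D x‖ := by
    intro x _; rw [norm_mul, Real.norm_eq_abs, abs_neg]
  have hzero := eq_zero_of_abs_deriv_le_mul_abs_self_of_eq_zero_right hDcont hDderiv hD0 hbound t
    ⟨ht, le_rfl⟩
  rw [hφψ t ht]
  have : ψ t - c * Real.exp (-lam * t) = 0 := hzero
  linarith

end Summit.QuantumFields.YangMills.Theorems.ColdStartUniversality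

end
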